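import Summits.CriticalPhenomena.PercolationContinuityZ3.Theorems.PercNearOneGluingNoHeavyLowerTailSahiOneStepProfileGridCoupling
import HarnessLib

/-!
# Profile grid, the covariance step: Efron + Chebyshev in the low sample (T1), Harris in the status vector (T2)

Prover prim-ineq-prove-3 gen 44 (`--supports stmt-CriticalPhenomena-4575`).  Third of four files (see `…ProfileGridPrelim`).

`gam N φ r t k = Σ_ñ (Π lo_j(ñ_j))·1[Σ ñ < t]·k(ñ)` is the low-sample functional restricted to the lower Hamming ball.
* (T1) `gam_mul_gam_le`: for a status vector `θ` in the support and a non-decreasing `a`,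
  `γ[a∘W_θ]·γ[1_H∘W_θ] ≤ γ[1]·γ[(a·1_H)∘W_θ]` (`H = {Σ ≥ t}`).  On the support `W_θ` depends only on the LOW coordinates `K` of `θ`
  and `1_H∘W_θ` is a threshold of the `K`-block sum; `γ` decomposes along the layers of the `K`-block sum (`gam_eq_sum_laySum`), the tilt
  and the `Kᶜ`-coordinates factor out (`laySum_mul_laySum_of_split`), and EFRON'S THEOREM in covariance form
  (`Literature.Probability.Distributions.efron_prefix_mul_le`, the `lo_j` being `PF₂`) concludes.
* (T2) `coupling_cov_nonneg`: `θ ↦ γ[a∘W_θ]`, `θ ↦ γ[1_H∘W_θ]` are non-decreasing and `ρ` is log-modular on the product of chains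
  `κ → Fin (N+2)`, so FKG (`Literature.Probability.LatticeModels.FKGEqualityChains.cov_nonneg`, Mathlib's four-functions theorem) and
  (T1) give `(Σ_θ ρ γ[a∘W])(Σ_θ ρ γ[1_H∘W]) ≤ (Σ ρ)·γ[1]·Σ_θ ρ γ[(a 1_H)∘W]`.
One definition (`gam`), no sorries.
-/

namespace Summit.CriticalPhenomena.PercolationContinuityZ3.Theorems

namespace SahiOneStep

namespace ProfileGrid

open Finset Function
open Literature.Probability.Distributions (IsLogConcaveSeq piWeight blockSum laySum laySum_def efron_prefix_mul_le)
open Literature.Probability.LatticeModels.FKGEqualityChains (mix IsLogSupermodular cov cov_nonneg)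
open Literature.Combinatorics.Sahi2008 (ex)

variable {κ : Type*} [Fintype κ] [DecidableEq κ] {N : ℕ}

/-! ## The tilted low functional `γ` and its layer structure -/

/-- The tilted low functional `γ[k] = Σ_ñ λ(ñ)·1[Σ ñ < t]·k(ñ)` (`λ = Π lo_j`): expectation over the low sample restricted to the
lower Hamming ball. [this work] -/
def gam (N : ℕ) (φ : κ → ℕ → ℝ) (r : κ → ℕ) (t : ℕ) (k : (κ → Fin (N + 1)) → ℝ) : ℝ :=
  ∑ ñ : κ → Fin (N + 1), piWeight N (loW φ r) ñ * (if blockSum univ ñ < t then k ñ else 0)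

section Gam

variable (φ : κ → ℕ → ℝ) (r : κ → ℕ) (t : ℕ)

/-- `γ` only sees `k` on the support box `{∀ j, ñ_j < r_j}`. [this work] -/
theorem gam_congr_supp {k k' : (κ → Fin (N + 1)) → ℝ} (h : ∀ ñ : κ → Fin (N + 1), (∀ j, (ñ j : ℕ) < r j) → k ñ = k' ñ) :
    gam N φ r t k = gam N φ r t k' := by
  unfold gam
  refine Fintype.sum_congr _ _ fun ñ => ?_
  by_cases hz : piWeight N (loW φ r) ñ = 0
  · rw [hz, zero_mul, zero_mul]
  · rw [h ñ (lt_of_piWeight_loW_ne_zero φ r hz)]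

/-- `γ` is monotone in `k` (nonnegative weights). [this work] -/
theorem gam_mono (hφ0 : ∀ j n, 0 ≤ φ j n) {k k' : (κ → Fin (N + 1)) → ℝ} (h : ∀ ñ, k ñ ≤ k' ñ) :
    gam N φ r t k ≤ gam N φ r t k' :=
  sum_le_sum fun ñ _ => mul_le_mul_of_nonneg_left (by split_ifs <;> [exact h ñ; exact le_rfl])
    (piWeight_nonneg (fun j n => loW_nonneg φ r hφ0 j n) ñ)

/-- `γ` is additive in `k`. [this work] -/
theorem gam_add (k k' : (κ → Fin (N + 1)) → ℝ) :
    gam N φ r t (fun ñ => k ñ + k' ñ) = gam N φ r t k + gam N φ r t k' := by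
  unfold gam; rw [← sum_add_distrib]
  exact Fintype.sum_congr _ _ fun ñ => by split_ifs <;> ring

/-- The block sum splits along `K` and its complement. [folklore] -/
theorem blockSum_univ_eq (K : Finset κ) (ñ : κ → Fin (N + 1)) :
    blockSum univ ñ = blockSum K ñ + blockSum (univ \ K) ñ := by
  unfold blockSum; rw [← sum_sdiff (subset_univ K)]; exact add_comm _ _

/-- The complementary block sum of `mix K x β` is that of `β`. [folklore] -/
theorem blockSum_sdiff_mix (K : Finset κ) (x β : κ → Fin (N + 1)) :
    blockSum (univ \ K) (mix (↑K : Set κ) x β) = blockSum (univ \ K) β := by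
  unfold blockSum
  exact sum_congr rfl fun j hj => by
    have : j ∉ (↑K : Set κ) := fun h => (mem_sdiff.1 hj).2 (mem_coe.1 h)
    simp only [mix, this, if_false]

/-- **Layer decomposition of `γ`** along the `K`-block sum, with the complementary tilt
`g_s(ñ) = 1[s + Σ_{j ∉ K} ñ_j < t]`. [this work] -/
theorem gam_eq_sum_laySum (K : Finset κ) (k : (κ → Fin (N + 1)) → ℝ) :
    gam N φ r t k = ∑ s ∈ range t, laySum N (loW φ r) K
      (fun ñ => (if s + blockSum (univ \ K) ñ < t then (1 : ℝ) else 0) * k ñ) s := by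
  unfold gam
  simp only [laySum_def]
  rw [sum_comm]
  refine Fintype.sum_congr _ _ fun ñ => ?_
  rw [blockSum_univ_eq K ñ, sum_ite_eq]
  by_cases hlt : blockSum K ñ < t
  · rw [if_pos (mem_range.2 hlt)]; split_ifs <;> ring
  · rw [if_neg (show ¬ (blockSum K ñ ∈ range t) from by rw [mem_range]; exact hlt),
      if_neg (show ¬ (blockSum K ñ + blockSum (univ \ K) ñ < t) from by omega), mul_zero]

/-- A factor depending only on the `K`-block sum comes out of a layer sum. [folklore] -/
theorem laySum_layer_factor (w : κ → ℕ → ℝ) (K : Finset κ) (f : ℕ → ℝ) (k : (κ → Fin (N + 1)) → ℝ) (s : ℕ) :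
    laySum N w K (fun ñ => f (blockSum K ñ) * k ñ) s = f s * laySum N w K k s := by
  rw [laySum_def, laySum_def, mul_sum]
  refine Fintype.sum_congr _ _ fun ñ => ?_
  split_ifs with h
  · rw [h]; ring
  · rw [mul_zero]

/-- An empty layer carries no mass of any `Φ`. [folklore] -/
theorem laySum_eq_zero_of_one {w : κ → ℕ → ℝ} (hw : ∀ j n, 0 ≤ w j n) (K : Finset κ) (Φ : (κ → Fin (N + 1)) → ℝ)
    {s : ℕ} (h0 : laySum N w K (fun _ => 1) s = 0) : laySum N w K Φ s = 0 := by
  rw [laySum_def] at h0 ⊢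
  have hterm := (sum_eq_zero_iff_of_nonneg (fun y _ => by
    split_ifs <;> [exact mul_nonneg (piWeight_nonneg hw y) zero_le_one; exact le_rfl])).1 h0
  refine sum_eq_zero fun y hy => ?_
  have := hterm y hy
  split_ifs with hy'
  · rw [if_pos hy', mul_one] at this; rw [this, zero_mul]
  · rfl

/-- Prefix/tail splitting on `range t`: `Σ_{s<t} 1[c ≤ s] f(s) = Σ_{s<t} f(s) − Σ_{s<min c t} f(s)`. [folklore] -/
theorem sum_range_ite_le (f : ℕ → ℝ) (c t : ℕ) :
    ∑ s ∈ range t, (if c ≤ s then f s else 0) = ∑ s ∈ range t, f s - ∑ s ∈ range (min c t), f s := by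
  rw [← sum_range_add_sum_Ico f (min_le_right c t), ← sum_range_add_sum_Ico (fun s => if c ≤ s then f s else 0)
    (min_le_right c t), sum_eq_zero (s := range (min c t)) (fun s hs => by
      rw [if_neg (fun hcs => absurd (lt_of_lt_of_le (mem_range.1 hs) (min_le_left c t)) (not_lt.2 hcs))]),
    zero_add, add_sub_cancel_left]
  exact sum_congr rfl fun s hs => by
    have h1 := (mem_Ico.1 hs).1
    have h2 := (mem_Ico.1 hs).2
    rw [if_pos (by by_contra hcs; have := lt_min (not_le.1 hcs) h2; omega)]

end Gam

/-! ## (T1): the all-low part — Efron + Chebyshev -/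

/-- **(T1)**  For a fixed status vector `θ` in the support, the tilted low functional is positively correlated on the pair
(`a ∘ W(θ, ·)`, `1[Σ W(θ, ·) ≥ t]`): `γ[F]·γ[G] ≤ γ[1]·γ[F G]`.  Proof: on the support `W = W_low` depends only on the low coordinates
`K`, `G` is a threshold of the `K`-block sum; decompose `γ` along the layers of the `K`-block sum (the tilt and the complementary
coordinates factor out by conditional independence, `laySum_mul_laySum_of_split`), and apply Efron's theorem in covariance form
(`efron_prefix_mul_le`) to the `PF₂` low weights. [this work] -/
theorem gam_mul_gam_le (φ : κ → ℕ → ℝ) (hφ : ∀ j, IsLogConcaveSeq (φ j)) (r : κ → ℕ) (t : ℕ)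
    {a : (κ → Fin (N + 1)) → ℝ} (ha : Monotone a) {θ : κ → Fin (N + 2)} (hθ : rho N φ r θ ≠ 0) :
    gam N φ r t (fun ñ => a (cpl θ ñ)) * gam N φ r t (fun ñ => if t ≤ blockSum univ (cpl θ ñ) then 1 else 0) ≤
      gam N φ r t (fun _ => 1) *
        gam N φ r t (fun ñ => a (cpl θ ñ) * if t ≤ blockSum univ (cpl θ ñ) then 1 else 0) := by
  have hφ0 : ∀ j n, 0 ≤ φ j n := fun j => (hφ j).1
  have hlo0 : ∀ j n, 0 ≤ loW φ r j n := fun j n => loW_nonneg φ r hφ0 j n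
  have hlo : ∀ j, IsLogConcaveSeq (loW φ r j) := isLogConcaveSeq_loW φ r hφ
  -- the low set, the high offset, the reduced threshold
  set K : Finset κ := univ.filter fun j => (θ j : ℕ) = 0 with hK
  set hs : ℕ := ∑ j ∈ univ.filter (fun j => ¬ (θ j : ℕ) = 0), ((θ j : ℕ) - 1) with hhs
  set c : ℕ := t - hs with hc
  have hθr : ∀ j, (θ j : ℕ) ≠ 0 → r j ≤ (θ j : ℕ) - 1 := fun j hj => le_pred_of_rho_ne_zero φ r hθ hj
  have hbs : ∀ ñ : κ → Fin (N + 1), blockSum univ (cplLow θ ñ) = blockSum K ñ + hs := by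
    intro ñ
    unfold blockSum
    rw [hK, hhs, ← sum_ite]
    exact sum_congr rfl fun j _ => by rw [cplLow_val]
  -- the reduced functions
  set F' : (κ → Fin (N + 1)) → ℝ := fun ñ => a (cplLow θ ñ) with hF'
  set G' : (κ → Fin (N + 1)) → ℝ := fun ñ => if c ≤ blockSum K ñ then 1 else 0 with hG'
  have eF : gam N φ r t (fun ñ => a (cpl θ ñ)) = gam N φ r t F' :=
    gam_congr_supp φ r t fun ñ hñ => by simp only [hF', cpl_eq_cplLow hñ hθr]
  have hGpt : ∀ ñ : κ → Fin (N + 1), (∀ j, (ñ j : ℕ) < r j) →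
      (if t ≤ blockSum univ (cpl θ ñ) then (1 : ℝ) else 0) = G' ñ := by
    intro ñ hñ
    simp only [hG', cpl_eq_cplLow hñ hθr, hbs, hc]
    by_cases h : c ≤ blockSum K ñ
    · rw [if_pos (by omega), if_pos (by omega)]
    · rw [if_neg (by omega), if_neg (by omega)]
  have eG : gam N φ r t (fun ñ => if t ≤ blockSum univ (cpl θ ñ) then 1 else 0) = gam N φ r t G' :=
    gam_congr_supp φ r t hGpt
  have eFG : gam N φ r t (fun ñ => a (cpl θ ñ) * if t ≤ blockSum univ (cpl θ ñ) then 1 else 0) =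
      gam N φ r t (fun ñ => G' ñ * F' ñ) :=
    gam_congr_supp φ r t fun ñ hñ => by rw [hGpt ñ hñ, mul_comm]; simp only [hF', cpl_eq_cplLow hñ hθr]
  rw [eF, eG, eFG]
  -- layer weights and the tilt `ω`
  set nK : ℕ → ℝ := laySum N (loW φ r) K (fun _ => 1) with hnK
  set gs : ℕ → (κ → Fin (N + 1)) → ℝ := fun s ñ => if s + blockSum (univ \ K) ñ < t then 1 else 0 with hgs
  set ω : ℕ → ℝ := fun s => laySum N (loW φ r) K (gs s) s / nK s with hω
  have hnK0 : ∀ s, 0 ≤ nK s := fun s => by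
    rw [hnK, laySum_def]; exact sum_nonneg fun y _ => by
      split_ifs <;> [exact mul_nonneg (piWeight_nonneg hlo0 y) zero_le_one; exact le_rfl]
  have hω0 : ∀ s, 0 ≤ ω s := fun s => by
    refine div_nonneg ?_ (hnK0 s)
    rw [laySum_def]; exact sum_nonneg fun y _ => by
      split_ifs <;> [exact mul_nonneg (piWeight_nonneg hlo0 y) (by simp only [hgs]; split_ifs <;> norm_num); exact le_rfl]
  -- factorisation: `L(g_s · k) = ω_s · L(k)` for `K`-measurable `k`
  have fac : ∀ k : (κ → Fin (N + 1)) → ℝ, (∀ x β, k (mix (↑K : Set κ) x β) = k x) → ∀ s,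
      laySum N (loW φ r) K (fun ñ => gs s ñ * k ñ) s = ω s * laySum N (loW φ r) K k s := by
    intro k hk s
    have hψ : ∀ x β : κ → Fin (N + 1), gs s (mix (↑K : Set κ) x β) = gs s β := fun x β => by
      simp only [hgs, blockSum_sdiff_mix]
    have h := laySum_mul_laySum_of_split (loW φ r) K (gs s) k hψ hk s
    by_cases hz : nK s = 0
    · rw [laySum_eq_zero_of_one hlo0 K _ hz, laySum_eq_zero_of_one hlo0 K k hz, mul_zero]
    · rw [hω]; field_simp; rw [hnK] at hz ⊢; linarith [h]
  have hF'mix : ∀ x β : κ → Fin (N + 1), F' (mix (↑K : Set κ) x β) = F' x := fun x β => by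
    simp only [hF', hK, cplLow_mix]
  have hG'mix : ∀ x β : κ → Fin (N + 1), G' (mix (↑K : Set κ) x β) = G' x := fun x β => by
    simp only [hG', blockSum_mix]
  -- the four values of `γ`
  set LF : ℕ → ℝ := laySum N (loW φ r) K F' with hLF
  have e1 : gam N φ r t F' = ∑ s ∈ range t, ω s * LF s := by
    rw [gam_eq_sum_laySum φ r t K]; exact sum_congr rfl fun s _ => fac F' hF'mix s
  have e2 : gam N φ r t (fun _ => 1) = ∑ s ∈ range t, ω s * nK s := by
    rw [gam_eq_sum_laySum φ r t K]; exact sum_congr rfl fun s _ => fac (fun _ => 1) (fun _ _ => rfl) s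
  have e3 : gam N φ r t G' = ∑ s ∈ range t, (if c ≤ s then ω s * nK s else 0) := by
    rw [gam_eq_sum_laySum φ r t K]
    refine sum_congr rfl fun s _ => ?_
    have eG1 : G' = fun ñ => (if c ≤ blockSum K ñ then (1 : ℝ) else 0) * (fun _ : κ → Fin (N + 1) => (1 : ℝ)) ñ := by
      funext ñ; simp only [hG', mul_one]
    rw [fac G' hG'mix s, eG1, laySum_layer_factor (loW φ r) K (fun m => if c ≤ m then (1 : ℝ) else 0) (fun _ => 1) s]
    split_ifs <;> simp [hnK]
  have e4 : gam N φ r t (fun ñ => G' ñ * F' ñ) = ∑ s ∈ range t, (if c ≤ s then ω s * LF s else 0) := by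
    rw [gam_eq_sum_laySum φ r t K]
    refine sum_congr rfl fun s _ => ?_
    rw [fac (fun ñ => G' ñ * F' ñ) (fun x β => by rw [hF'mix, hG'mix]) s, hG',
      laySum_layer_factor (loW φ r) K (fun m => if c ≤ m then (1 : ℝ) else 0) F' s]
    split_ifs <;> simp [hLF]
  rw [e1, e2, e3, e4, sum_range_ite_le, sum_range_ite_le]
  -- Efron in covariance form
  have hF'mono : Monotone F' := fun x y h => ha (cplLow_mono_right θ h)
  rcases Nat.eq_zero_or_pos t with ht | ht
  · subst ht; simp
  · have key := efron_prefix_mul_le (loW φ r) hlo K F' hF'mono ω hω0 (c := min c t) (M := t - 1)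
      (by have := min_le_right c t; omega)
    rw [show t - 1 + 1 = t from by omega] at key
    nlinarith [key]

/-! ## (T2): Harris on the status vector (product of chains, Mathlib's four-functions FKG) -/

/-- `γ[a ∘ W(θ, ·)]` is non-decreasing in the status vector `θ`. [this work] -/
theorem gam_cpl_mono (φ : κ → ℕ → ℝ) (hφ0 : ∀ j n, 0 ≤ φ j n) (r : κ → ℕ) (t : ℕ)
    {a : (κ → Fin (N + 1)) → ℝ} (ha : Monotone a) :
    Monotone fun θ : κ → Fin (N + 2) => gam N φ r t (fun ñ => a (cpl θ ñ)) :=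
  fun _ _ h => gam_mono φ r t hφ0 fun ñ => ha (cpl_mono_left h ñ)

/-- `γ[1[Σ W(θ, ·) ≥ t]]` is non-decreasing in `θ`. [this work] -/
theorem gam_ind_cpl_mono (φ : κ → ℕ → ℝ) (hφ0 : ∀ j n, 0 ≤ φ j n) (r : κ → ℕ) (t : ℕ) :
    Monotone fun θ : κ → Fin (N + 2) => gam N φ r t (fun ñ => if t ≤ blockSum univ (cpl θ ñ) then (1 : ℝ) else 0) := by
  intro θ θ' h
  refine gam_mono φ r t hφ0 fun ñ => ?_
  have hle : blockSum univ (cpl θ ñ) ≤ blockSum univ (cpl θ' ñ) :=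
    sum_le_sum fun j _ => by exact_mod_cast (cpl_mono_left h ñ) j
  by_cases h1 : t ≤ blockSum univ (cpl θ ñ)
  · rw [if_pos h1, if_pos (h1.trans hle)]
  · rw [if_neg h1]; split_ifs <;> norm_num

/-- **(T2) + (T1)**: the covariance of `a(W)` and `1[Σ W ≥ t]` under the coupling restricted to `{Σ ñ < t}` is nonnegative:
`(Σ_θ ρ γ[F_θ])·(Σ_θ ρ γ[G_θ]) ≤ (Σ_θ ρ)·γ[1]·Σ_θ ρ γ[F_θ G_θ]`. [this work] -/
theorem coupling_cov_nonneg (φ : κ → ℕ → ℝ) (hφ : ∀ j, IsLogConcaveSeq (φ j)) (r : κ → ℕ) (t : ℕ)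
    {a : (κ → Fin (N + 1)) → ℝ} (ha : Monotone a) :
    (∑ θ : κ → Fin (N + 2), rho N φ r θ * gam N φ r t (fun ñ => a (cpl θ ñ))) *
        (∑ θ : κ → Fin (N + 2), rho N φ r θ * gam N φ r t (fun ñ => if t ≤ blockSum univ (cpl θ ñ) then 1 else 0)) ≤
      (∑ θ : κ → Fin (N + 2), rho N φ r θ) * (gam N φ r t (fun _ => 1) *
        ∑ θ : κ → Fin (N + 2), rho N φ r θ *
          gam N φ r t (fun ñ => a (cpl θ ñ) * if t ≤ blockSum univ (cpl θ ñ) then 1 else 0)) := by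
  have hφ0 : ∀ j n, 0 ≤ φ j n := fun j => (hφ j).1
  -- (T2): FKG on the product of chains `κ → Fin (N+2)` for the product weight `ρ`
  have hlsm : IsLogSupermodular (rho N φ r) := isLogSupermodular_prod (fun j => thetaW N φ r j)
  have hfkg := cov_nonneg (μ := rho N φ r) (fun θ => rho_nonneg φ r hφ0 θ) hlsm (gam_cpl_mono φ hφ0 r t ha)
    (gam_ind_cpl_mono φ hφ0 r t)
  rw [cov, ex, ex, ex, sub_nonneg] at hfkg
  simp only [Pi.mul_apply] at hfkg
  -- (T1) termwise
  have ht1 : ∑ θ : κ → Fin (N + 2), rho N φ r θ * (gam N φ r t (fun ñ => a (cpl θ ñ)) *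
      gam N φ r t (fun ñ => if t ≤ blockSum univ (cpl θ ñ) then 1 else 0)) ≤
      ∑ θ : κ → Fin (N + 2), rho N φ r θ * (gam N φ r t (fun _ => 1) *
        gam N φ r t (fun ñ => a (cpl θ ñ) * if t ≤ blockSum univ (cpl θ ñ) then 1 else 0)) := by
    refine sum_le_sum fun θ _ => ?_
    by_cases hz : rho N φ r θ = 0
    · rw [hz, zero_mul, zero_mul]
    · exact mul_le_mul_of_nonneg_left (gam_mul_gam_le φ hφ r t ha hz) (rho_nonneg φ r hφ0 θ)
  have hR : 0 ≤ ∑ θ : κ → Fin (N + 2), rho N φ r θ := sum_nonneg fun θ _ => rho_nonneg φ r hφ0 θ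
  calc _ ≤ (∑ θ : κ → Fin (N + 2), rho N φ r θ) * ∑ θ : κ → Fin (N + 2), rho N φ r θ *
        (gam N φ r t (fun ñ => a (cpl θ ñ)) * gam N φ r t (fun ñ => if t ≤ blockSum univ (cpl θ ñ) then 1 else 0)) := hfkg
    _ ≤ (∑ θ : κ → Fin (N + 2), rho N φ r θ) * ∑ θ : κ → Fin (N + 2), rho N φ r θ * (gam N φ r t (fun _ => 1) *
        gam N φ r t (fun ñ => a (cpl θ ñ) * if t ≤ blockSum univ (cpl θ ñ) then 1 else 0)) :=
        mul_le_mul_of_nonneg_left ht1 hR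
    _ = _ := by rw [mul_sum, mul_sum, mul_sum]; exact sum_congr rfl fun θ _ => by ring

end ProfileGrid

end SahiOneStep

end Summit.CriticalPhenomena.PercolationContinuityZ3.Theorems
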